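import Literature.AnabelianGeometry.AbsoluteAnabelian.UnitKummerNaturalityColimit
import Literature.AnabelianGeometry.AbsoluteAnabelian.UnitKummerTransport
import Literature.AnabelianGeometry.AbsoluteAnabelian.MLFGaloisGroupification
import Literature.AnabelianGeometry.EtaleTheta.KummerFunctorialityCovariantIso
import HarnessLib

/-!
# [AbsTopIII] Prop 3.3 (i) on ABSTRACT MLF-Galois `TLG`-pairs: naturality of the unit Kummer maps along
# morphisms of pairs and canonicity of the transported unit Kummer theory (independence of the presentation)

S. Mochizuki, *Topics in absolute anabelian geometry III*, §3, Prop. 3.3 (i) p. 73 (bib key `MochizukiAbsTopIII2015`;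
locators = kurims manuscript pages, lit key `paper:url-5493eb38cbb7`): for `T ∈ {TLG, TCG}` and an MLF-Galois `T`-pair
`(Π ↷ M)`, "functorial algorithms for constructing the Kummer maps `M^H → H¹(H, μ_Ẑ(M))`", functorial «relative to
`C^MLF_T`» whose morphisms are those of Def. 3.1 (ii) p. 67.

abc-iut cell, layer L4, row «Prop33i-ABSTRACT-PAIR (b)(c) TWIN» (abc-iut-L4-lead RULINGS #5y / #6a; seat
abc-iut-w4-d009 gen 4): the `TLG` twin of abc-iut-L4-t2's `MonoidKummerTransportCanonical.lean` (Prop. 3.2 (ii), `TM`),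
decl for decl.  State of the tree: `UnitKummerModel.lean` (abc-iut-L4-t2) builds the unit Kummer theory of the MODEL
`TLG`-pair `(Π_k ↷ k̄^×)`; `UnitKummerTransport.lean` transports it along an isomorphism `e : (Π_k ↷ k̄^×) ⥲ P` to any
abstract MLF-Galois `TLG`-pair (`exists_unitKummerTheory_TLG_injective` — an `∃`-packaging over a CHOSEN presentation);
`UnitKummerNaturality(Covariant).lean` (this seat) prove the naturality of the MODEL unit Kummer maps along arbitrary
equivariant pairs.  This file closes, for `TLG`, the two abstract-pair clauses the layer registry records as open:

* `GaloisMonoidPair.TLGPresentation P` — the data `(k, k̄, Π_k ↠ G_k, e : (Π_k ↷ k̄^×) ⥲ P)` witnessing `P ∈ C^MLF_TLG`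
  (inhabited iff `IsMLFGaloisMonoidPair .TLG P`, `nonempty_iff`); `TLGPresentation.unitKummerTheory π := (model).transport e`;
* (b) **naturality on abstract pairs** `TLGPresentation.kummer_natural`: for a Def. 3.1 (ii) morphism `f : P → Q` of
  abstract pairs with presentations `π`, `ϖ`, open `H ⊆ Π`, `H' ⊆ Π'` with `f_Π(H) ⊆ H'`, `m ∈ M^H`, `f_M m ∈ M'^{H'}`:
  `pull (κ'_{H'}(f_M m)) = push (κ_H(m))` along the transition pair `(e'⁻¹ f_Π e, e'⁻¹ f_M e)` of models, read on `k̄ˣ`;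
* (c) **canonicity** `TLGPresentation.canonicalEquiv π₁ π₂ H` + **`canonicalEquiv_kummer`**: for two presentations of the
  SAME pair, the comparison isomorphism of the transition ISOMORPHISM `e₂⁻¹e₁` (abc-iut-L4-t2's
  `EquivariantMorphism.comparisonIso`, both cospan legs invertible) identifies the carriers and carries `κ⁽¹⁾_H(m)` to
  `κ⁽²⁾_H(m)` — the unit Kummer maps of the `∃`-packaged theory do not depend on the chosen model.

Also: `ModelMLFGaloisData.tlgUnitsMap_smul_of_smul` / `tlg_kummer_natural_of_smul` — the model square of
`UnitKummerNaturalityCovariant.lean` for a RAW equivariant pair `(φ_Π, φ_M)` (no Def. 3.1 (ii) side conditions needed).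
`TCG` twin: separate file (intrinsic coefficients `Λ((𝒪_k̄^×)ˣ)`).  Mathlib's `groupCohomology` is single-universe:
everything cohomological at universe `0`.  HONEST FRAMING: classical Kummer theory at OUR model objects; the unit Kummer
theories are still OBTAINED from models; nothing here bears on [IUTchIII] Cor. 3.12; no side taken.
-/

noncomputable section

open scoped nonZeroDivisors

namespace Literature.AnabelianGeometry.AbsoluteAnabelian

open _root_.CategoryTheory
open Literature.AnabelianGeometry.EtaleTheta (kummerClass invariants cyclotomeRep EquivariantMorphism)

universe u

/-! ### The model square for a raw equivariant pair `(φ_Π, φ_M)` on `(Π_k ↷ k̄^×)` -/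

namespace ModelMLFGaloisData

variable {C₁ C₂ : MLFClosure.{u}} {D₁ : ModelMLFGaloisData C₁.k C₁.K} {D₂ : ModelMLFGaloisData C₂.k C₂.K}

/-- For an equivariant pair `(φ_Π : Π_{k₁} → Π_{k₂}, φ_M : k̄₁^× → k̄₂^×)` (`φ_M(g • x) = φ_Π(g) • φ_M(x)` on the
monoids `(k̄ᵢ)⁰`), the unit map `φ_M` read on `k̄ˣ` is `φ_Π`-equivariant. [cite: MochizukiAbsTopIII2015, Definition 3.1 (ii) p.67] -/
theorem tlgUnitsMap_smul_of_smul (φ : D₁.Pi →* D₂.Pi) (ψ : (C₁.K)⁰ →* (C₂.K)⁰)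
    (h : ∀ (g : D₁.Pi) (x : (C₁.K)⁰), ψ (g • x) = φ g • ψ x) (g : D₁.Pi) (u : (C₁.K)ˣ) :
    (nonZeroDivisorsEquivUnits.toMonoidHom.comp
        (ψ.comp (nonZeroDivisorsEquivUnits (G₀ := C₁.K)).symm.toMonoidHom)) (g • u) =
      φ g • (nonZeroDivisorsEquivUnits.toMonoidHom.comp
        (ψ.comp (nonZeroDivisorsEquivUnits (G₀ := C₁.K)).symm.toMonoidHom)) u := by
  refine Units.ext ?_
  have hx : (nonZeroDivisorsEquivUnits (G₀ := C₁.K)).symm (g • u) =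
      g • (nonZeroDivisorsEquivUnits (G₀ := C₁.K)).symm u := Subtype.ext rfl
  change (((ψ ((nonZeroDivisorsEquivUnits (G₀ := C₁.K)).symm (g • u)) : (C₂.K)⁰)) : C₂.K) =
    D₂.aug (φ g) • ((ψ ((nonZeroDivisorsEquivUnits (G₀ := C₁.K)).symm u) : (C₂.K)⁰) : C₂.K)
  rw [hx, h]
  rfl

/-- The units equivariant morphism `(Π_{k₁} ↷ k̄₁ˣ) → (Π_{k₂} ↷ k̄₂ˣ)` of a raw equivariant pair on the `TLG` models.
[cite: MochizukiAbsTopIII2015, Definition 3.1 (ii) p.67] -/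
abbrev tlgUnitsMorphism (φ : D₁.Pi →* D₂.Pi) (ψ : (C₁.K)⁰ →* (C₂.K)⁰)
    (h : ∀ (g : D₁.Pi) (x : (C₁.K)⁰), ψ (g • x) = φ g • ψ x) :
    EquivariantMorphism D₁.Pi (C₁.K)ˣ D₂.Pi (C₂.K)ˣ :=
  ⟨φ, nonZeroDivisorsEquivUnits.toMonoidHom.comp (ψ.comp (nonZeroDivisorsEquivUnits (G₀ := C₁.K)).symm.toMonoidHom),
    tlgUnitsMap_smul_of_smul φ ψ h⟩

end ModelMLFGaloisData

namespace ModelMLFGaloisData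

variable {C₁ C₂ : MLFClosure.{0}} {D₁ : ModelMLFGaloisData C₁.k C₁.K} {D₂ : ModelMLFGaloisData C₂.k C₂.K}

/-- **The model `TLG` square for a RAW equivariant pair** (as `GaloisMonoidPair.Hom.tlgUnitsMorphism_pullH1_kummer`, without
the Def. 3.1 (ii) side conditions on kernels/openness, which the cohomology does not use): for open `H₁`, `H₂` with
`φ_Π(H₁) ≤ H₂` and `m₁ ∈ (k̄₁^×)^{H₁}`, `m₂ ∈ (k̄₂^×)^{H₂}` with `φ_M m₁ = m₂`: `φ_Π^* κ_{H₂}(m₂) = Λ(φ_M)_* κ_{H₁}(m₁)` for t2's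
model unit Kummer maps. [cite: MochizukiAbsTopIII2015, Proposition 3.3 (i) p.73] -/
theorem tlg_kummer_natural_of_smul (φ : D₁.Pi →* D₂.Pi) (ψ : (C₁.K)⁰ →* (C₂.K)⁰)
    (h : ∀ (g : D₁.Pi) (x : (C₁.K)⁰), ψ (g • x) = φ g • ψ x)
    {H₁ : OpenSubgroup D₁.tlgPair.Pi} {H₂ : OpenSubgroup D₂.tlgPair.Pi}
    (hH : (H₁ : Subgroup D₁.Pi).map φ ≤ (H₂ : Subgroup D₂.Pi))
    (m₁ : {m : D₁.tlgPair.M // ∀ g : H₁, (g : D₁.tlgPair.Pi) • m = m})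
    (m₂ : {m : D₂.tlgPair.M // ∀ g : H₂, (g : D₂.tlgPair.Pi) • m = m}) (hm : ψ m₁.1 = m₂.1) :
    (tlgUnitsMorphism φ ψ h).pullH1 hH ((D₂.unitKummerTheoryTLG C₂).kummer H₂ m₂) =
      (tlgUnitsMorphism φ ψ h).pushH1 hH ((D₁.unitKummerTheoryTLG C₁).kummer H₁ m₁) := by
  rw [unitKummerTheoryTLG_kummer, unitKummerTheoryTLG_kummer]
  refine EquivariantMorphism.pullH1_kummerClass _ hH _ _ ?_
  change nonZeroDivisorsEquivUnits (ψ ((nonZeroDivisorsEquivUnits (G₀ := C₁.K)).symm (tlgToUnit C₁ m₁.1))) =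
    tlgToUnit C₂ m₂.1
  rw [tlgToUnit_eq_nonZeroDivisorsEquivUnits, tlgToUnit_eq_nonZeroDivisorsEquivUnits, MulEquiv.symm_apply_apply, hm]

end ModelMLFGaloisData

/-! ### `TLG` presentations of an abstract pair and their unit Kummer theories -/

namespace GaloisMonoidPair

/-- A **`TLG` model presentation** of an abstract pair `P = (Π ↷ M)`: model data `(k, k̄, ε_k : Π_k ↠ G_k)` (Def. 3.1 (i))
together with an isomorphism of pairs `e : (Π_k ↷ k̄^×) ⥲ (Π ↷ M)` (Def. 3.1 (ii)) — the witness that `P` is an MLF-Galois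
`TLG`-pair. [cite: MochizukiAbsTopIII2015, Definition 3.1 (ii) p.67] -/
structure TLGPresentation (P : GaloisMonoidPair.{u}) : Type (u + 1) where
  /-- the MLF `k` with an algebraic closure `k̄` -/
  C : MLFClosure.{u}
  /-- the model data `ε_k : Π_k ↠ G_k` -/
  D : ModelMLFGaloisData C.k C.K
  /-- the isomorphism of pairs `(Π_k ↷ k̄^×) ⥲ P` -/
  iso : GaloisMonoidPair.Iso D.tlgPair P

namespace TLGPresentation

section General

variable {P Q : GaloisMonoidPair.{u}}

/-- A pair admits a `TLG` presentation iff it is an MLF-Galois `TLG`-pair (Def. 3.1 (ii)).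
[cite: MochizukiAbsTopIII2015, Definition 3.1 (ii) p.67] -/
theorem nonempty_iff : Nonempty P.TLGPresentation ↔ IsMLFGaloisMonoidPair .TLG P := by
  constructor
  · rintro ⟨π⟩
    exact ⟨⟨π.C, π.D, π.D.tlgPair, π.D.monoidPair_TLG, ⟨π.iso⟩⟩⟩
  · intro hP
    obtain ⟨C, D, Q₀, hQ₀, ⟨e⟩⟩ := hP.exists_model
    have hQ' : D.tlgPair = Q₀ := Option.some_injective _ (D.monoidPair_TLG.symm.trans hQ₀)
    subst hQ'
    exact ⟨⟨C, D, e⟩⟩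

/-- The open subgroup `e⁻¹(H) ⊆ Π_k` of the model corresponding to an open `H ⊆ Π` under a presentation.
[cite: MochizukiAbsTopIII2015, Definition 3.1 (ii) p.67] -/
abbrev comapOpen (π : P.TLGPresentation) (H : OpenSubgroup P.Pi) : OpenSubgroup π.D.tlgPair.Pi :=
  H.comap π.iso.isoPi.toMonoidHom π.iso.isoPi.continuous

end General

section UnitKummerTheory

variable {P : GaloisMonoidPair.{0}}

/-- **The unit Kummer theory of a `TLG` presentation**: the model unit Kummer theory (`unitKummerTheoryTLG`, Prop. 3.3 (i))
transported along `e` (`UnitKummerTheory.transport`) — the theory packaged existentially in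
`exists_unitKummerTheory_TLG_injective`.  Its `H¹(H)` IS the genuine `H¹(e⁻¹H, Λ(k̄ˣ))` (Mathlib `groupCohomology.H1`).
[cite: MochizukiAbsTopIII2015, Proposition 3.3 (i) p.73] -/
def unitKummerTheory (π : P.TLGPresentation) : UnitKummerTheory .TLG P :=
  (π.D.unitKummerTheoryTLG π.C).transport π.iso

/-- The Kummer map of `π.unitKummerTheory` at `H`, unfolded: the model Kummer class at `e⁻¹H` of `e⁻¹m`.
[cite: MochizukiAbsTopIII2015, Proposition 3.3 (i) p.73] -/
theorem unitKummerTheory_kummer (π : P.TLGPresentation) (H : OpenSubgroup P.Pi)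
    (m : {m : P.M // ∀ h : H, (h : P.Pi) • m = m}) :
    π.unitKummerTheory.kummer H m = (π.D.unitKummerTheoryTLG π.C).kummer (π.comapOpen H)
      ⟨π.iso.isoM.symm m.1, fun g => π.iso.smul_symm_eq_of_mem_comap m.2 g⟩ :=
  rfl

end UnitKummerTheory

/-! ### The transition pair of a morphism between presented pairs -/

section Transition

variable {P Q : GaloisMonoidPair.{u}} (f : GaloisMonoidPair.Hom P Q) (π : P.TLGPresentation) (ϖ : Q.TLGPresentation)

/-- The transition homomorphism `e'⁻¹ ∘ f_Π ∘ e : Π_k → Π_{k'}` of a morphism of presented pairs.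
[cite: MochizukiAbsTopIII2015, Definition 3.1 (ii) p.67] -/
def transitionPi : π.D.Pi →* ϖ.D.Pi :=
  (ϖ.iso.isoPi.symm.toMonoidHom.comp f.homPi).comp π.iso.isoPi.toMonoidHom

/-- The transition homomorphism `e'⁻¹ ∘ f_M ∘ e : k̄^× → k̄'^×` of a morphism of presented pairs.
[cite: MochizukiAbsTopIII2015, Definition 3.1 (ii) p.67] -/
def transitionM : (π.C.K)⁰ →* (ϖ.C.K)⁰ :=
  (ϖ.iso.isoM.symm.toMonoidHom.comp f.homM).comp π.iso.isoM.toMonoidHom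

/-- `transitionPi` on elements. [cite: MochizukiAbsTopIII2015, Definition 3.1 (ii) p.67] -/
@[simp] theorem transitionPi_apply (g : π.D.Pi) :
    transitionPi f π ϖ g = ϖ.iso.isoPi.symm (f.homPi (π.iso.isoPi g)) := rfl

/-- `transitionM` on elements. [cite: MochizukiAbsTopIII2015, Definition 3.1 (ii) p.67] -/
@[simp] theorem transitionM_apply (m : (π.C.K)⁰) :
    transitionM f π ϖ m = ϖ.iso.isoM.symm (f.homM (π.iso.isoM m)) := rfl

/-- The transition pair is equivariant. [cite: MochizukiAbsTopIII2015, Definition 3.1 (ii) p.67] -/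
theorem transition_smul (g : π.D.Pi) (m : (π.C.K)⁰) :
    transitionM f π ϖ (g • m) = transitionPi f π ϖ g • transitionM f π ϖ m := by
  change ϖ.iso.symm.isoM (f.homM (π.iso.isoM (g • m))) =
    ϖ.iso.symm.isoPi (f.homPi (π.iso.isoPi g)) • ϖ.iso.symm.isoM (f.homM (π.iso.isoM m))
  rw [π.iso.smul_comm, f.smul_comm, ϖ.iso.symm.smul_comm]

/-- `f_Π(H) ⊆ H'` implies `(e'⁻¹ f_Π e)(e⁻¹H) ⊆ e'⁻¹H'`. [cite: MochizukiAbsTopIII2015, Definition 3.1 (ii) p.67] -/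
theorem map_transitionPi_le {H : OpenSubgroup P.Pi} {H' : OpenSubgroup Q.Pi}
    (hH : (H : Subgroup P.Pi).map f.homPi ≤ (H' : Subgroup Q.Pi)) :
    ((π.comapOpen H : OpenSubgroup π.D.tlgPair.Pi) : Subgroup π.D.Pi).map (transitionPi f π ϖ) ≤
      ((ϖ.comapOpen H' : OpenSubgroup ϖ.D.tlgPair.Pi) : Subgroup ϖ.D.Pi) := by
  rintro _ ⟨x, hx, rfl⟩
  change ϖ.iso.isoPi (ϖ.iso.isoPi.symm (f.homPi (π.iso.isoPi x))) ∈ (H' : Subgroup Q.Pi)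
  rw [ContinuousMulEquiv.apply_symm_apply]
  exact hH ⟨π.iso.isoPi x, hx, rfl⟩

end Transition

/-! ### (b) Naturality of the unit Kummer maps on abstract `TLG`-pairs -/

section Natural

variable {P Q : GaloisMonoidPair.{0}} (f : GaloisMonoidPair.Hom P Q) (π : P.TLGPresentation) (ϖ : Q.TLGPresentation)

/-- The units equivariant morphism `(Π_k ↷ k̄ˣ) → (Π_{k'} ↷ k̄'ˣ)` underlying the transition pair of `f`.
[cite: MochizukiAbsTopIII2015, Definition 3.1 (ii) p.67] -/
abbrev transitionMorphism : EquivariantMorphism π.D.Pi (π.C.K)ˣ ϖ.D.Pi (ϖ.C.K)ˣ :=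
  ModelMLFGaloisData.tlgUnitsMorphism (transitionPi f π ϖ) (transitionM f π ϖ) (transition_smul f π ϖ)

/-- **[AbsTopIII] Prop 3.3 (i) — naturality of the unit Kummer maps along a morphism of ABSTRACT MLF-Galois `TLG`-pairs.**
Let `f = (f_Π, f_M) : (Π ↷ M) → (Π' ↷ M')` be a morphism of pairs (Def. 3.1 (ii)) with `TLG` presentations `π = (k, e)`,
`ϖ = (k', e')`, let `H ⊆ Π`, `H' ⊆ Π'` be open with `f_Π(H) ⊆ H'`, and `m ∈ M^H` with `f_M(m) ∈ M'^{H'}`.  Then, in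
`H¹(e⁻¹H, res Λ(k̄'ˣ))`, `pull (κ'_{H'}(f_M m)) = push (κ_H(m))` for the unit Kummer maps `κ = π.unitKummerTheory.kummer`,
`κ' = ϖ.unitKummerTheory.kummer` (carriers `H¹(e⁻¹H, Λ(k̄ˣ))`, `H¹(e'⁻¹H', Λ(k̄'ˣ))`), pull/push along the transition pair
`(e'⁻¹ f_Π e, e'⁻¹ f_M e)` — "a functorial algorithm for constructing the Kummer maps".
[cite: MochizukiAbsTopIII2015, Proposition 3.3 (i) p.73] -/
theorem kummer_natural (H : OpenSubgroup P.Pi) (H' : OpenSubgroup Q.Pi)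
    (hH : (H : Subgroup P.Pi).map f.homPi ≤ (H' : Subgroup Q.Pi))
    (m : {m : P.M // ∀ h : H, (h : P.Pi) • m = m})
    (hm : ∀ h : H', (h : Q.Pi) • f.homM m.1 = f.homM m.1) :
    (transitionMorphism f π ϖ).pullH1 (map_transitionPi_le f π ϖ hH)
        (ϖ.unitKummerTheory.kummer H' ⟨f.homM m.1, hm⟩) =
      (transitionMorphism f π ϖ).pushH1 (map_transitionPi_le f π ϖ hH) (π.unitKummerTheory.kummer H m) := by
  rw [unitKummerTheory_kummer, unitKummerTheory_kummer]
  refine ModelMLFGaloisData.tlg_kummer_natural_of_smul (transitionPi f π ϖ) (transitionM f π ϖ)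
    (transition_smul f π ϖ) (map_transitionPi_le f π ϖ hH) _ _ ?_
  change ϖ.iso.isoM.symm (f.homM (π.iso.isoM (π.iso.isoM.symm m.1))) = ϖ.iso.isoM.symm (f.homM m.1)
  rw [MulEquiv.apply_symm_apply]

end Natural

/-! ### (c) Canonicity: two `TLG` presentations of the same pair -/

section Canonical

variable {P : GaloisMonoidPair.{u}} (π₁ π₂ : P.TLGPresentation)

/-- The **change-of-presentation isomorphism** `e₂⁻¹ ∘ e₁ : (Π_{k₁} ↷ k̄₁^×) ⥲ (Π_{k₂} ↷ k̄₂^×)` between the two models.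
[cite: MochizukiAbsTopIII2015, Definition 3.1 (ii) p.67] -/
def changeIso : GaloisMonoidPair.Iso π₁.D.tlgPair π₂.D.tlgPair := π₁.iso.trans π₂.iso.symm

/-- `changeIso` on the groups: `g ↦ e₂⁻¹(e₁ g)`. [cite: MochizukiAbsTopIII2015, Definition 3.1 (ii) p.67] -/
@[simp] theorem changeIso_isoPi_apply (g : π₁.D.Pi) :
    (changeIso π₁ π₂).isoPi g = π₂.iso.isoPi.symm (π₁.iso.isoPi g) := rfl

/-- `changeIso` on the monoids: `m ↦ e₂⁻¹(e₁ m)`. [cite: MochizukiAbsTopIII2015, Definition 3.1 (ii) p.67] -/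
@[simp] theorem changeIso_isoM_apply (m : π₁.D.tlgPair.M) :
    (changeIso π₁ π₂).isoM m = π₂.iso.isoM.symm (π₁.iso.isoM m) := rfl

/-- The units equivariant morphism of the change of presentation. [cite: MochizukiAbsTopIII2015, Definition 3.1 (ii) p.67] -/
abbrev changeMorphism : EquivariantMorphism π₁.D.Pi (π₁.C.K)ˣ π₂.D.Pi (π₂.C.K)ˣ :=
  ModelMLFGaloisData.tlgUnitsMorphism (changeIso π₁ π₂).isoPi.toMonoidHom (changeIso π₁ π₂).isoM.toMonoidHom
    (changeIso π₁ π₂).smul_comm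

/-- `e₂⁻¹ e₁` maps `e₁⁻¹H` into `e₂⁻¹H`. [cite: MochizukiAbsTopIII2015, Definition 3.1 (ii) p.67] -/
theorem map_changeIso_le (H : OpenSubgroup P.Pi) :
    ((π₁.comapOpen H : OpenSubgroup π₁.D.tlgPair.Pi) : Subgroup π₁.D.Pi).map (changeIso π₁ π₂).isoPi.toMonoidHom ≤
      ((π₂.comapOpen H : OpenSubgroup π₂.D.tlgPair.Pi) : Subgroup π₂.D.Pi) := by
  rintro _ ⟨x, hx, rfl⟩
  change π₂.iso.isoPi (π₂.iso.isoPi.symm (π₁.iso.isoPi x)) ∈ (H : Subgroup P.Pi)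
  rw [ContinuousMulEquiv.apply_symm_apply]
  exact hx

/-- `e₂⁻¹ e₁ : e₁⁻¹H → e₂⁻¹H` is bijective. [cite: MochizukiAbsTopIII2015, Definition 3.1 (ii) p.67] -/
theorem changeIso_restrict_bijective (H : OpenSubgroup P.Pi) :
    Function.Bijective ((changeMorphism π₁ π₂).groupHomRestrict (map_changeIso_le π₁ π₂ H)) := by
  constructor
  · intro x y hxy
    apply Subtype.ext
    have h := congrArg (fun z : π₂.comapOpen H => ((z : π₂.D.Pi))) hxy
    exact (changeIso π₁ π₂).isoPi.injective h
  · intro y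
    refine ⟨⟨(changeIso π₁ π₂).isoPi.symm y, ?_⟩, Subtype.ext ?_⟩
    · change π₁.iso.isoPi ((changeIso π₁ π₂).isoPi.symm y) ∈ (H : Subgroup P.Pi)
      have hy : π₂.iso.isoPi (y : π₂.D.Pi) ∈ (H : Subgroup P.Pi) := y.2
      convert hy using 1
      change π₁.iso.isoPi (π₁.iso.isoPi.symm (π₂.iso.isoPi (y : π₂.D.Pi))) = _
      rw [ContinuousMulEquiv.apply_symm_apply]
    · exact (changeIso π₁ π₂).isoPi.apply_symm_apply y

/-- The units component of the change of presentation (`e₂⁻¹e₁` read on `k̄ˣ`) is bijective.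
[cite: MochizukiAbsTopIII2015, Definition 3.1 (ii) p.67] -/
theorem changeMorphism_map_bijective : Function.Bijective (changeMorphism π₁ π₂).map :=
  (((nonZeroDivisorsEquivUnits (G₀ := π₁.C.K)).symm.trans (changeIso π₁ π₂).isoM).trans
    (nonZeroDivisorsEquivUnits (G₀ := π₂.C.K))).bijective

end Canonical

section CanonicalEquiv

variable {P : GaloisMonoidPair.{0}} (π₁ π₂ : P.TLGPresentation) (H : OpenSubgroup P.Pi)

/-- **The canonical identification of the cohomology carriers of two `TLG` presentations**:
`(π₁.unitKummerTheory).H¹(H) = H¹(e₁⁻¹H, Λ(k̄₁ˣ)) ≅ H¹(e₂⁻¹H, Λ(k̄₂ˣ)) = (π₂.unitKummerTheory).H¹(H)` — the comparison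
isomorphism of abc-iut-L4-t2's `EquivariantMorphism.comparisonIso` (pull-back along `e₂⁻¹e₁ : e₁⁻¹H ⥲ e₂⁻¹H`,
push-forward along `Λ(e₂⁻¹e₁)`, both invertible). [cite: MochizukiAbsTopIII2015, Proposition 3.3 (i) p.73] -/
def canonicalIso :
    groupCohomology.H1 (cyclotomeRep (A := (π₁.C.K)ˣ)
        ((π₁.comapOpen H : OpenSubgroup π₁.D.tlgPair.Pi) : Subgroup π₁.D.Pi)) ≅
      groupCohomology.H1 (cyclotomeRep (A := (π₂.C.K)ˣ)
        ((π₂.comapOpen H : OpenSubgroup π₂.D.tlgPair.Pi) : Subgroup π₂.D.Pi)) :=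
  (changeMorphism π₁ π₂).comparisonIso (map_changeIso_le π₁ π₂ H)
    (changeIso_restrict_bijective π₁ π₂ H) (changeMorphism_map_bijective π₁ π₂)

/-- The same identification as an additive isomorphism of the carriers
`(π₁.unitKummerTheory).coh.H1 H ≃+ (π₂.unitKummerTheory).coh.H1 H`. [cite: MochizukiAbsTopIII2015, Proposition 3.3 (i) p.73] -/
def canonicalEquiv : π₁.unitKummerTheory.coh.H1 H ≃+ π₂.unitKummerTheory.coh.H1 H :=
  (canonicalIso π₁ π₂ H).toLinearEquiv.toAddEquiv

/-- `canonicalEquiv` is the underlying map of `canonicalIso`. [cite: MochizukiAbsTopIII2015, Proposition 3.3 (i) p.73] -/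
theorem canonicalEquiv_apply (x : π₁.unitKummerTheory.coh.H1 H) :
    canonicalEquiv π₁ π₂ H x = (canonicalIso π₁ π₂ H).hom x := rfl

/-- **CANONICITY of the transported unit Kummer theory ([AbsTopIII] Prop 3.3 (i) on abstract `TLG`-pairs).**  For two
`TLG` presentations `π₁ = (k₁, e₁)`, `π₂ = (k₂, e₂)` of the same pair `P = (Π ↷ M)`, every open `H ⊆ Π` and every `m ∈ M^H`,
the canonical identification of carriers takes the unit Kummer class of `m` for `π₁` to the one for `π₂`:
`canonicalEquiv (κ⁽¹⁾_H(m)) = κ⁽²⁾_H(m)`.  Hence the unit Kummer maps packaged existentially in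
`exists_unitKummerTheory_TLG_injective` are independent of the chosen model, up to canonical isomorphism.
[cite: MochizukiAbsTopIII2015, Proposition 3.3 (i) p.73] -/
theorem canonicalEquiv_kummer (m : {m : P.M // ∀ h : H, (h : P.Pi) • m = m}) :
    canonicalEquiv π₁ π₂ H (π₁.unitKummerTheory.kummer H m) = π₂.unitKummerTheory.kummer H m := by
  rw [canonicalEquiv_apply, unitKummerTheory_kummer, unitKummerTheory_kummer,
    ModelMLFGaloisData.unitKummerTheoryTLG_kummer, ModelMLFGaloisData.unitKummerTheoryTLG_kummer]
  refine (changeMorphism π₁ π₂).comparisonIso_kummerClass (map_changeIso_le π₁ π₂ H)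
    (changeIso_restrict_bijective π₁ π₂ H) (changeMorphism_map_bijective π₁ π₂) _ _ ?_
  change nonZeroDivisorsEquivUnits ((changeIso π₁ π₂).isoM
      ((nonZeroDivisorsEquivUnits (G₀ := π₁.C.K)).symm (ModelMLFGaloisData.tlgToUnit π₁.C (π₁.iso.isoM.symm m.1)))) =
    ModelMLFGaloisData.tlgToUnit π₂.C (π₂.iso.isoM.symm m.1)
  rw [ModelMLFGaloisData.tlgToUnit_eq_nonZeroDivisorsEquivUnits,
    ModelMLFGaloisData.tlgToUnit_eq_nonZeroDivisorsEquivUnits, MulEquiv.symm_apply_apply, changeIso_isoM_apply,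
    MulEquiv.apply_symm_apply]

end CanonicalEquiv

end TLGPresentation

end GaloisMonoidPair

end Literature.AnabelianGeometry.AbsoluteAnabelian

end
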